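import Summits.BirchSwinnertonDyer.BirchSwinnertonDyer.Theorems.Rank1ResidualJetKolyvaginLocalTerm
import Summits.BirchSwinnertonDyer.BirchSwinnertonDyer.Theorems.KolyvaginRankRigidityAtTwoSwapFrobeniusEigenLinesAtTwo
import Summits.BirchSwinnertonDyer.BirchSwinnertonDyer.Theorems.KolyvaginRankRigidityAtTwoSwapUnramifiedEvalEquiv
import HarnessLib

/-!
# Crux V2♭θ `KolyvaginCorankLowerBoundAtTwoTheta` (stmt-BirchSwinnertonDyer-27220), line
# `kolyvagin_depth_split`, inside of S1, piece P7a — bricks D/E at `2`: the `s`-eigen-subgroup of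
# `σ_{*,λ}` on the local Kummer group `Kum_λ ≤ H¹(K_λ, E[2^k])` at a Kolyvagin prime at `2` with
# Gross's Frobenius condition has `≤ 2^{k+1}` elements and contains a class of order `2^k`
# (helper, PROVED; width seat `bsd-line-krr2-p2` g6)

Road-K JET's `natCard_kummer_inf_ker_conjActPlace_eq_pow` (`p` odd): `#(Kum_λ ∩ ker(σ_* − s)) = p^k`.
At `2` the eigen-subgroups of `Kum_λ ≅ E[2^k]` are `ℤ/2^k ⊕ ℤ/2` or `ℤ/2^k`; what the prime-swap
pairing estimate needs (`SwapPairing.pow_smul_eval_ne_zero_of_eigen` via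
`SwapPairing.exists_eq_zsmul_add_of_card_le_of_mem`) is exactly: COUNT `≤ 2^{k+1}` and ONE eigen-class
of order `2^k`.  This file proves both, for `K` imaginary quadratic, `τ ≠ 1`, a Zhang–Kolyvagin prime
`ℓ` at `2` with `k ≤ M(ℓ)` AND `FrobEqFrobInfty W K (2^{M'}) ℓ` (`k ≤ M'`), `λ ∋ ℓ`, `τ • λ = λ`:
* `torsionMap_eigen_at_two` — on `E[2^k](K̄)` for ANY lift `t` of `τ` whose transport stabilises a
  prime above `λ` (brick D at `2`: brick C + the seat's brick B at `2`
  `natCard_ker_frob_sub_smul_le_of_frobEqFrobInfty` / `exists_frob_eigen_pow_smul_ne_zero`);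
* `kummer_eigen_at_two` — on `Kum_λ ∩ ker(conjActPlace W τ (2^k) hfix − s)` (brick E count
  `natCard_unramified_inf_ker_conjActPlace_eq` + the seat's evaluation equivalence
  `exists_mem_unramified_eigen_zsmul_ne_zero`, `Kum_λ = H¹_ur`).
HONEST FRAMING: helper lemmas (`--supports` 27220); S1 / V2♭θ are NOT proved; BSD is not proved.

References: [Jetchev2008] §3.2 (2)–(3), Prop. 4.2; [GrossLMS1991] §3 (3.2)–(3.4), §4;
[NeukirchANT1999] Ch. I §9, Ch. II §9 Prop. (9.6).
-/

set_option autoImplicit false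
-- the Theorems namespace of this sub repeats the summit name by design (D-0017 nested layout)
set_option linter.dupNamespace false

noncomputable section

open scoped Classical Pointwise NumberField Valued
open WeierstrassCurve Field Function NumberField IsDedekindDomain ValuativeRel Rat.HeightOneSpectrum
open Literature.NumberTheory.EllipticCurves Literature.NumberTheory.GaloisRepresentations
open Literature.NumberTheory.GaloisRepresentations.IsNonarchimedeanLocalField
open Literature.NumberTheory.GaloisCohomology Literature.NumberTheory.Automorphic
open Literature.AnabelianGeometry.AbsoluteAnabelian
open _root_.TopRep _root_.ContinuousCohomology
open Summit.BirchSwinnertonDyer.Rank1Residual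
open Summit.BirchSwinnertonDyer.Rank1Residual.X11b.Three.Koly.Method2
open Summit.BirchSwinnertonDyer.Rank1Residual.JET.GlobalDuality

namespace Summit.BirchSwinnertonDyer.BirchSwinnertonDyer.Theorems.KolyvaginLowerBoundAtTwo

variable (W : WeierstrassCurve ℚ) (K : Type) [Field K] [NumberField K] [W.IsElliptic] [W.IsGloballyMinimal]

/-- **Brick D at `2`.** For `K` imaginary quadratic, `τ ≠ 1`, a Zhang–Kolyvagin prime `ℓ` at `2`
with `1 ≤ k ≤ M(ℓ)` and Gross's condition `FrobEqFrobInfty W K (2^{M'}) ℓ` (`k ≤ M'`), `w ∋ ℓ`,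
`𝔓 ∣ w`, and ANY lift `t` of `τ` to `K̄` whose transport `γ ∈ Γ_ℚ` stabilises `𝔓 ∩ \bar ℤ`: the
`s`-eigen-subgroup of `t_*` on `E[2^k](K̄)` has `≤ 2^{k+1}` elements and contains a point of order
`2^k`. As in road-K brick D, `γ` acts on `E[2^k](ℚ̄)` as a `ℚ`-Frobenius `h'` at `𝔓 ∩ \bar ℤ`
(`g₀ = h'⁻¹ γ` fixes `K`, lies in `G_𝔓`, and `G_𝔓` fixes `E[2^k](K̄)` — brick C); brick B at `2`
does the rest. [cite: GrossLMS1991, §3 (3.1)–(3.4)] [cite: Jetchev2008, §3.2 (2) (p. 815)]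
[cite: NeukirchANT1999, Ch. I §9 Prop. (9.4)] -/
theorem torsionMap_eigen_at_two (hK : IsImaginaryQuadratic K) {k ℓ M' : ℕ} (hk1 : 1 ≤ k)
    (hℓ : Zhang2014.IsKolyvaginPrime (W.conductorNorm ℤ) W K 2 ℓ)
    (hk : k ≤ Zhang2014.kolyvaginIndex W 2 ℓ) (hF : FrobEqFrobInfty W K (2 ^ M') ℓ) (hkM' : k ≤ M')
    (w : HeightOneSpectrum (𝓞 K)) (hw : (ℓ : 𝓞 K) ∈ w.asIdeal)
    {𝔓 : Ideal (absIntegers (𝓞 K) K)} (h𝔓 : 𝔓 ∈ w.primesAbove)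
    {τ : K ≃ₐ[ℚ] K} (hτ1 : τ ≠ 1) {t : AlgebraicClosure K ≃+* AlgebraicClosure K} (ht : IsLiftOfAut τ t)
    {γ : absoluteGaloisGroup ℚ} (hγ : ∀ x, t x = absGaloisTransport (K := ℚ) (L := K) γ x)
    (hγD : γ ∈ (𝔓.comap (absIntegersMap ℚ K)).decompositionSubgroup (absoluteGaloisGroup ℚ))
    {s : ℤ} (hs : s = 1 ∨ s = -1) :
    Nat.card (ht.torsionMap W ((2 ^ k : ℕ) : ℤ) - s • AddMonoidHom.id _).ker ≤ 2 ^ (k + 1) ∧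
      ∃ Q : geomTorsion (W.baseChange K) ((2 ^ k : ℕ) : ℤ),
        ht.torsionMap W ((2 ^ k : ℕ) : ℤ) Q = s • Q ∧ (2 ^ (k - 1)) • Q ≠ 0 := by
  have hℓp : ℓ.Prime := hℓ.1
  have hℓ2 : ℓ ≠ 2 := hℓ.2.2.2.1
  have hℓP : (Ideal.span {(ℓ : 𝓞 K)}).IsPrime := hℓ.2.2.2.2.1
  set n : ℤ := ((2 ^ k : ℕ) : ℤ) with hn
  -- ### the place `v₁` of `ℚ` below `w`, the prime `𝔓'`, a Frobenius `h'`
  set v₁ : HeightOneSpectrum (𝓞 ℚ) := w.under (𝓞 ℚ) with hv₁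
  have hwv₁ : w.asIdeal.under (𝓞 ℚ) = v₁.asIdeal := rfl
  have hℓv₁ : (ℓ : 𝓞 ℚ) ∈ v₁.asIdeal := by
    rw [← hwv₁, Ideal.under_def, Ideal.mem_comap, map_natCast]; exact hw
  have hgood₁ : W.HasGoodReductionAt v₁ :=
    LocalFrob.hasGoodReductionAt_rat_of_not_dvd_conductorNorm W hℓp hℓ.2.1 v₁ hℓv₁
  set 𝔓' := 𝔓.comap (absIntegersMap ℚ K) with h𝔓'def
  have h𝔓' : 𝔓' ∈ v₁.primesAbove := comap_absIntegersMap_mem_primesAbove hwv₁ h𝔓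
  haveI : 𝔓'.IsPrime := h𝔓'.1
  obtain ⟨h', hh'⟩ := HeightOneSpectrum.exists_isArithFrobAt_of_mem_primesAbove_holds h𝔓'
  -- ### `h'` lifts `τ`; `g₀ = h'⁻¹ γ` fixes `K`, so `g₀ = res g₁` with `g₁ ∈ G_𝔓`
  have hlift : IsLiftOfAut τ (absGaloisTransport (K := ℚ) (L := K) h').toRingEquiv :=
    isLiftOfAut_absGaloisTransport_of_isArithFrobAt K hK hτ1 hℓp hℓP hw h𝔓 hℓv₁ h𝔓' hh'
  set g₀ : absoluteGaloisGroup ℚ := h'⁻¹ * γ with hg₀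
  have hg₀K : g₀ ∈ Set.range (absGaloisRestrict ℚ K) := by
    rw [mem_range_absGaloisRestrict_iff]
    intro x
    rw [hg₀, map_mul, map_inv, AlgEquiv.mul_apply, ← hγ, ht x]
    have hx : absGaloisTransport (K := ℚ) (L := K) h' (algebraMap K (AlgebraicClosure K) x) =
        algebraMap K (AlgebraicClosure K) (τ x) := hlift x
    rw [← hx, ← AlgEquiv.mul_apply, inv_mul_cancel, AlgEquiv.one_apply]
  obtain ⟨g₁, hg₁⟩ := hg₀K
  have hg₁D : g₁ ∈ 𝔓.decompositionSubgroup (absoluteGaloisGroup K) := by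
    rw [← comap_decompositionSubgroup_comap_absIntegersMap ℚ K 𝔓, Subgroup.mem_comap]
    change absGaloisRestrict ℚ K g₁ ∈ 𝔓'.decompositionSubgroup (absoluteGaloisGroup ℚ)
    rw [hg₁, hg₀]
    exact Subgroup.mul_mem _ (Subgroup.inv_mem _ hh'.mem_stabilizer) hγD
  -- `g₀` acts trivially on `E[2^k](ℚ̄)` (brick C at `p = 2`)
  have hg₀P : ∀ P : geomTorsion W n, g₀ • P = P := fun P => by
    apply (RatClosure.torsionEquiv (K := K) W n).injective
    rw [← hg₁, RatClosure.torsionEquiv_smul,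
      smul_torsion_eq_self_of_mem_decompositionSubgroup W K hK hℓ hk w hw h𝔓 hg₁D]
  -- ### so `γ` acts on `E[2^k](ℚ̄)` as `h'`
  have hγP : ∀ P : geomTorsion W n, γ • P = h' • P := fun P => by
    have e : γ = h' * g₀ := by rw [hg₀, mul_inv_cancel_left]
    rw [e, mul_smul, hg₀P]
  have hFr : IsArithFrobAtPlace ℚ v₁ h' := ⟨𝔓', h𝔓', hh'⟩
  -- ### transport along `E[2^k](ℚ̄) ≃ E[2^k](K̄)`, which carries `γ` to `t_*`
  have hmem : ∀ P : geomTorsion W n,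
      P ∈ (DistribSMul.toAddMonoidHom (geomTorsion W n) h' - s • AddMonoidHom.id _).ker ↔
        RatClosure.torsionEquiv (K := K) W n P ∈ (ht.torsionMap W n - s • AddMonoidHom.id _).ker := by
    intro P
    rw [AddMonoidHom.mem_ker, AddMonoidHom.mem_ker, AddMonoidHom.sub_apply, AddMonoidHom.sub_apply,
      AddMonoidHom.smul_apply, AddMonoidHom.smul_apply, AddMonoidHom.id_apply, AddMonoidHom.id_apply,
      ← RatClosure.torsionEquiv_smul_of_lift W ht γ hγ n P, hγP, ← map_zsmul, ← map_sub,
      map_eq_zero_iff _ (RatClosure.torsionEquiv (K := K) W n).injective]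
    rfl
  refine ⟨?_, ?_⟩
  · rw [← Nat.card_congr ((RatClosure.torsionEquiv (K := K) W n).toEquiv.subtypeEquiv hmem)]
    exact natCard_ker_frob_sub_smul_le_of_frobEqFrobInfty W hℓp hℓ2 hF hk1 hkM' hℓv₁ hgood₁ hFr hs
  · obtain ⟨P₀, hP₀, hP₀ne⟩ :=
      exists_frob_eigen_pow_smul_ne_zero W hℓp hℓ2 hF hk1 hkM' hℓv₁ hgood₁ hFr hs
    refine ⟨RatClosure.torsionEquiv (K := K) W n P₀, ?_, fun h0 => hP₀ne ?_⟩
    · rw [← RatClosure.torsionEquiv_smul_of_lift W ht γ hγ n P₀, hγP, hP₀, map_zsmul]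
    · rw [← map_nsmul, map_eq_zero_iff _ (RatClosure.torsionEquiv (K := K) W n).injective] at h0
      exact h0

/-- **Bricks D/E at `2` on the local Kummer group.** `K` imaginary quadratic, `τ ≠ 1`, `ℓ` a
Zhang–Kolyvagin prime at `2` with `1 ≤ k ≤ M(ℓ)` and `FrobEqFrobInfty W K (2^{M'}) ℓ` (`k ≤ M'`),
`v ∋ ℓ` with `τ • v = v`, `s = ±1`: the `s`-eigen-subgroup of `conjActPlace W τ (2^k) hfix` on
`Kum_v ≤ H¹(K_v, E[2^k])` has AT MOST `2^{k+1}` elements and contains a class `c` with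
`2^{k-1} • c ≠ 0`. (`Kum_v = H¹_ur`, evaluation at a Frobenius `H¹_ur ≃+ E[2^k](K̄)` carrying
`σ_*` to the adapted lift `τ̃_*`, and `torsionMap_eigen_at_two` for `τ̃ = liftAutPlace τ hfix`.)
Jetchev 2008 §3.2 (2) / Prop. 4.2 at the prime `2`. [cite: Jetchev2008, §3.2 (2) (p. 815), Prop. 4.2]
[cite: GrossLMS1991, §3 (3.2)–(3.4)] -/
theorem kummer_eigen_at_two (hK : IsImaginaryQuadratic K) {k ℓ M' : ℕ} (hk1 : 1 ≤ k)
    (hℓ : Zhang2014.IsKolyvaginPrime (W.conductorNorm ℤ) W K 2 ℓ)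
    (hk : k ≤ Zhang2014.kolyvaginIndex W 2 ℓ) (hF : FrobEqFrobInfty W K (2 ^ M') ℓ) (hkM' : k ≤ M')
    (v : HeightOneSpectrum (𝓞 K)) (hv : (ℓ : 𝓞 K) ∈ v.asIdeal)
    {τ : K ≃ₐ[ℚ] K} (hτ1 : τ ≠ 1) (hfix : τ • v = v) {s : ℤ} (hs : s = 1 ∨ s = -1) :
    Nat.card ↥((W.baseChange K).kummerSelmerStructure ((2 ^ k : ℕ) : ℤ) (Sum.inr v) ⊓
        (conjActPlace W τ ((2 ^ k : ℕ) : ℤ) hfix - s • AddMonoidHom.id _).ker) ≤ 2 ^ (k + 1) ∧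
      ∃ c : galoisCohomology
          (((W.baseChange K).torsionGaloisModule ((2 ^ k : ℕ) : ℤ)).toLocal (Sum.inr v : Place K)) 1,
        c ∈ (W.baseChange K).kummerSelmerStructure ((2 ^ k : ℕ) : ℤ) (Sum.inr v) ⊓
            (conjActPlace W τ ((2 ^ k : ℕ) : ℤ) hfix - s • AddMonoidHom.id _).ker ∧
          (2 ^ (k - 1)) • c ≠ 0 := by
  haveI : Fact (Nat.Prime 2) := ⟨Nat.prime_two⟩
  obtain ⟨hgood, hpv⟩ := hasGoodReductionAt_of_zhangKolyvaginPrime W K hℓ v hv 1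
  have hpv' : ((2 : ℕ) : 𝓞 K) ∉ v.asIdeal := by rwa [pow_one, Int.cast_natCast] at hpv
  have hKum := X11b.KummerPT.kummerSelmerStructure_inr_eq_unramifiedSubgroup (W.baseChange K) 2 k hpv'
    hgood
  obtain ⟨γ, hγ, hγD⟩ := exists_transport_liftAutPlace_mem_decompositionSubgroup K τ hfix
  obtain ⟨hDcount, Q, hQ, hQne⟩ := torsionMap_eigen_at_two W K hK hk1 hℓ hk hF hkM' v hv
    (adicCompletionPrime_mem_primesAbove K v) hτ1 (isLiftOfAut_liftAutPlace τ hfix) hγ hγD hs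
  have hKum' : ((W.baseChange K).kummerSelmerStructure ((2 ^ k : ℕ) : ℤ) (Sum.inr v) ⊓
        (conjActPlace W τ ((2 ^ k : ℕ) : ℤ) hfix - s • AddMonoidHom.id _).ker) =
      (DiscreteGaloisModule.unramifiedSubgroup
          (GaloisRep.toLocal v ((W.baseChange K).torsionGaloisModule ((2 ^ k : ℕ) : ℤ))) 1 ⊓
        (conjActPlace W τ ((2 ^ k : ℕ) : ℤ) hfix - s • AddMonoidHom.id _).ker) := by
    rw [hKum]
    rfl
  refine ⟨?_, ?_⟩
  · -- the count, through brick E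
    have hE := natCard_unramified_inf_ker_conjActPlace_eq W K hK hℓ hk v hv τ hfix s
    have h1 := congrArg (fun A : AddSubgroup (galoisCohomology
        (((W.baseChange K).torsionGaloisModule ((2 ^ k : ℕ) : ℤ)).toLocal (Sum.inr v : Place K)) 1) =>
      Nat.card ↥A) hKum'
    exact (h1.trans hE).le.trans hDcount
  · -- the class of order `2^k`, through the evaluation equivalence
    set L := v.adicCompletion K with hL
    set ρ := GaloisRep.toLocal v ((W.baseChange K).torsionGaloisModule ((2 ^ k : ℕ) : ℤ)) with hρ
    haveI : Finite (geomTorsion (W.baseChange K) ((2 ^ k : ℕ) : ℤ)) :=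
      finite_torsionPoints_holds (W.baseChange K) (AlgebraicClosure K) (by positivity)
    obtain ⟨φ, hφ⟩ := exists_isAbsArithFrob_holds L
    have hφ1 : IsFrobPow φ 1 := IsAbsArithFrob.isFrobPow_holds hφ
    set hτ := isLiftOfAut_liftAutPlace τ hfix with hτdef
    set hΘ := isLiftOfRingEquiv_ringEquivLift (galAdicCompletionEquiv (L := K) τ hfix) with hΘdef
    set hc := liftsCommute_liftAutPlace τ hfix with hcdef
    have hQz : ((2 ^ (k - 1) : ℕ) : ℤ) • Q ≠ 0 := by rwa [natCast_zsmul]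
    have hex := exists_mem_unramified_eigen_zsmul_ne_zero ρ
      (galoisRep_toLocal_apply_eq_self W K hK hℓ hk v hv) hφ1
      (conjActPlace W τ ((2 ^ k : ℕ) : ℤ) hfix) (hτ.torsionMap W ((2 ^ k : ℕ) : ℤ))
      (fun g => hΘ.conjGalCMH g) ?hT (isFrobPow_conjGalCMH K τ hfix hΘ hφ1) ?hfI s hQ hQz
    case hT =>
      intro ψ
      refine ⟨contOneCocycles.pullback hΘ.conjGalCMH (localConjHom W hτ hΘ hc ((2 ^ k : ℕ) : ℤ)) ψ,
        ?_, fun g => ?_⟩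
      · exact localConjH1_oneCocycleClass W hτ hΘ hc ((2 ^ k : ℕ) : ℤ) ψ
      · rw [contOneCocycles.pullback_apply]
        rfl
    case hfI =>
      intro i hi
      rw [← isFrobPow_zero_iff_mem_absInertia] at hi ⊢
      exact isFrobPow_conjGalCMH K τ hfix hΘ hi
    obtain ⟨c, hcmem, hcne⟩ := hex
    have hcne' : (2 ^ (k - 1)) • c ≠ 0 := by rwa [natCast_zsmul] at hcne
    have hc' : c ∈ (W.baseChange K).kummerSelmerStructure ((2 ^ k : ℕ) : ℤ) (Sum.inr v) ⊓
        (conjActPlace W τ ((2 ^ k : ℕ) : ℤ) hfix - s • AddMonoidHom.id _).ker := by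
      rw [hKum']; exact hcmem
    exact ⟨c, hc', hcne'⟩

end Summit.BirchSwinnertonDyer.BirchSwinnertonDyer.Theorems.KolyvaginLowerBoundAtTwo

end
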